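import Summits.Schanuel.Schanuel.Theorems.RootDecomp1BMovingZero17
import Literature.NumberTheory.Transcendental.PhilipponCriterionDescend
import Literature.NumberTheory.Transcendental.ProjectiveNoIsolatedPoints
import Literature.NumberTheory.Transcendental.NesterenkoEliminationProp411Holds
import Literature.NumberTheory.Transcendental.NesterenkoEliminationProp47Holds
import Literature.NumberTheory.Transcendental.NesterenkoEliminationFacts2Proofs
import Literature.NumberTheory.Transcendental.NesterenkoUResultantIntCoeffs
import Literature.NumberTheory.Transcendental.NesterenkoIntegerHeights
import Literature.NumberTheory.Transcendental.PhilipponCriterionRankOne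
import Literature.NumberTheory.Transcendental.PhilipponCriterionConeRank
import Literature.NumberTheory.Transcendental.PhilipponCriterionPrincipal
import Literature.NumberTheory.Transcendental.NesterenkoEliminationZeros
import Mathlib.Analysis.Polynomial.MahlerMeasure

/-!
# RootDecomp1BMovingZero — lens 4, generation 39 «ISOLATED POINT BOUND, SLOT DISCHARGED» (lane B-R24 (a) / RULE B-R25): the last B-side print input `IsolatedPointBound` (FACT B, part 11) of the moving-zero cell DISCHARGED up to its parameter-free numeral — `def IsolatedPointBoundN` (part 11's text with `(2n+3)·log(n+1) ↦ 6n³`) and `theorem isolatedPointBoundN_holds : IsolatedPointBoundN` HYPOTHESIS-FREE from the tree's proved Nesterenko–Philippon elimination theory; `ApproxOfIsolated ρ` UNCONDITIONAL for every real ρ; `MovingZeroApprox ρ` modulo `AxRankBoundLaurent` only; the (1|ρ) storey cell modulo {Ax, LWMeasure, ExplicitRatExpApprox} — continuation (RootDecomp1BMovingZero18): namespace IsolatedPt §E1–§E3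

(lens-4 g39 HOME kernel IsolatedPointDischarge.lean dce96aa4…, 1262 l, imports tree MovingZero17 + the Literature elimination theory (PhilipponCriterionDescend / ProjectiveNoIsolatedPoints / NesterenkoEliminationProp411Holds / Prop47Holds / Facts2Proofs / NesterenkoUResultantIntCoeffs / NesterenkoIntegerHeights / PhilipponCriterionRankOne / ConeRank / Principal / NesterenkoEliminationZeros) + Mathlib MahlerMeasure; CLAIM L2051, RULING + RULE B-R25 + CHECKLIST B-g39 L2053, NODE L2060 / REQUEST L2061 / RESULT L2062, critic VERDICT L2063 (crit g8: CLEARED — THEOREM ×1 for the SLOT under RULE B-R25; lens-4 tally THEOREM ×6 + CELL ×2; the moving-zero cell's named inputs of record = {AxRankBoundLaurent, LWMeasure, ExplicitRatExpApprox}; PORT GO); port by census-1 gen 18 as `RootDecomp1BMovingZero18`–`22`: 18 = `namespace IsolatedPt` §E1–§E3 (binary forms at `(1,t)`, algebraicity of the coordinates on a rank-one prime, no point at infinity); 19 = §E4a the `u`-resultant read on the lines `τ e₀ − e_{j+1}` (`zpart` / `gPoly` / `uVec` / `pairExp`, coefficient and degree lemmas); 20 = §E4b the rank-one endgame `IsolatedPt.exists_poly_of_rank_one`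 (integer Chow form + Mahler measure) + §D the TRACKED DESCENT `IsolatedPt.descent_tracked` + §A arithmetic (`log_mvPolyHeight_le`, `junk_absorb`, `sharp_le_junk`); 21 = §N `def IsolatedPointBoundN`, (γ) `isolatedPointBoundN_of_isolatedPointBound`, THE DISCHARGE `isolatedPointBoundN_holds` (kind definition, `--no-relocate`); 22 = §B consumers re-run (`isolatedPointBoundN_five`, `height_side_leN`, `approxOfIsolated_of_factsN`, `movingZeroApprox_of_factsN`, `approxOfIsolated_holds`, `approxOfIsolated_of_ax`, `movingZeroApprox_of_ax`) + the four cells `four_le_polarDeg_one/swap/one_hyper/one_rhoT_of_ax`.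
PORT EDITS: the `AxiomGuards` section (7 `#guard_msgs in #print axioms`), the unused `import HarnessLib` and `set_option linter.dupNamespace false` dropped; eleven one-line docstrings added; statements and proofs verbatim. `--supports stmt-Schanuel-24622`; no census credit carried; rung 0 — nothing here proves Schanuel.)
-/

noncomputable section

attribute [local instance] MvPolynomial.gradedAlgebra

open MvPolynomial
open Literature.NumberTheory.Transcendental
open Literature.NumberTheory.Transcendental.Nesterenko
open Literature.NumberTheory.Transcendental.PhilipponMain

namespace Summit.Schanuel.Schanuel.Theorems.RootDecomp1BMovingZero

namespace IsolatedPt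

/-! ## §E1  Binary forms vanishing at `(1, t)`, `t` transcendental -/

/-- If every homogeneous component of `P ∈ ℚ[x₀,x₁]` vanishes at `(1, t)` with `t` transcendental
over `ℚ`, then `P = 0`. -/
theorem eq_zero_of_mem_coneIdeal_pair {t : ℂ} (ht : Transcendental ℚ t) {P : Rx 1}
    (hP : P ∈ coneIdeal (![1, t] : Fin (1 + 1) → ℂ)) : P = 0 := by
  classical
  rw [mem_coneIdeal_iff] at hP
  -- the dehomogenised components
  have key : ∀ n : ℕ, ∀ d ∈ P.support, d.degree = n → False := by
    intro n d hd hdn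
    set S : Finset (Fin (1 + 1) →₀ ℕ) := P.support.filter (fun e => e.degree = n) with hS
    set q : Polynomial ℚ := ∑ e ∈ S, Polynomial.C (coeff e P) * Polynomial.X ^ (e 1) with hq
    have hev : Polynomial.aeval t q =
        aeval (![1, t] : Fin (1 + 1) → ℂ) (homogeneousComponent n P) := by
      simp only [hq, homogeneousComponent_apply, map_sum]
      refine Finset.sum_congr rfl fun e _ => ?_
      rw [aeval_monomial, Finsupp.prod_fintype _ _ (fun i => by simp)]
      simp [Fin.prod_univ_succ]
    have hq0 : q = 0 := by
      by_contra hq0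
      exact ht ⟨q, hq0, by rw [hev]; exact hP n⟩
    have hdS : d ∈ S := Finset.mem_filter.mpr ⟨hd, hdn⟩
    have hcoef : q.coeff (d 1) = coeff d P := by
      rw [hq, Polynomial.finsetSum_coeff]
      simp only [Polynomial.coeff_C_mul_X_pow]
      rw [Finset.sum_eq_single_of_mem d hdS]
      · simp
      · intro e he hne
        rw [if_neg]
        intro h1
        apply hne
        have hen : e.degree = n := (Finset.mem_filter.mp he).2
        have hsum_e : e 0 + e 1 = n := by
          rw [← hen, Finsupp.degree_eq_sum]; simp [Fin.sum_univ_succ]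
        have hsum_d : d 0 + d 1 = n := by
          rw [← hdn, Finsupp.degree_eq_sum]; simp [Fin.sum_univ_succ]
        ext i
        fin_cases i
        · exact (show e 0 = d 0 by omega)
        · exact (show e 1 = d 1 from h1.symm)
    have : coeff d P = 0 := by rw [← hcoef, hq0, Polynomial.coeff_zero]
    exact (mem_support_iff.mp hd) this
  ext d
  rw [coeff_zero]
  by_contra h
  exact key (d.degree) d (mem_support_iff.mpr h) rfl

/-! ## §E2  The affine coordinates of a point on a rank-one prime are algebraic -/

/-- For a homogeneous prime `𝔔 ⊂ ℚ[x₀,…,x_m]` of Nesterenko rank `1` and an affine point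
`(1 : z) ∈ V(𝔔)`, every coordinate `z j` is algebraic over `ℚ` (transcendence degree count:
`dim ℚ[x]/𝔔 = trdeg = 1`, while `x₀, x_{j+1}` would be algebraically independent modulo
`𝔔 = 𝔭_{(1:z)}` if `z j` were transcendental). -/
theorem isAlgebraic_of_rank_one {m : ℕ} {𝔔 : Ideal (Rx m)} (h𝔔 : 𝔔.IsPrime)
    (h𝔔c : ∀ g ∈ 𝔔, ∀ k : ℕ, homogeneousComponent k g ∈ 𝔔) (h1 : IsUnmixedOfRank 𝔔 1)
    {z : Fin m → ℂ} (hz : (Fin.cons 1 z : Fin (m + 1) → ℂ) ∈ projZeros 𝔔) (j : Fin m) :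
    IsAlgebraic ℚ (z j) := by
  classical
  have hcone := eq_coneIdeal_of_rank_one h𝔔 h𝔔c h1 hz
  have hP : ringKrullDim (Rx m ⧸ 𝔔) = (1 : ℕ) := ringKrullDim_quotient_eq_of_isUnmixedOfRank h𝔔 h1
  haveI : IsDomain (Rx m ⧸ 𝔔) := Ideal.Quotient.isDomain 𝔔
  haveI : Algebra.FiniteType ℚ (Rx m ⧸ 𝔔) :=
    Algebra.FiniteType.of_surjective (Ideal.Quotient.mkₐ ℚ 𝔔) (Ideal.Quotient.mkₐ_surjective ℚ 𝔔)
  have hdim := Literature.RingTheory.KrullDimension.ringKrullDim_eq_trdeg ℚ (Rx m ⧸ 𝔔)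
  have hfin : Algebra.trdeg ℚ (Rx m ⧸ 𝔔) < Cardinal.aleph0 :=
    trdeg_lt_aleph0 (R := ℚ) (S := Rx m ⧸ 𝔔)
  have htr : Algebra.trdeg ℚ (Rx m ⧸ 𝔔) = 1 := by
    obtain ⟨r, hr⟩ := Cardinal.lt_aleph0.mp hfin
    rw [hdim, hr, Cardinal.toNat_natCast] at hP
    have : r = 1 := by exact_mod_cast hP
    rw [hr, this, Nat.cast_one]
  by_contra htrans
  -- the pair `(x₀, x_{j+1})` is algebraically independent modulo `𝔔`
  let x : Fin 2 → Rx m ⧸ 𝔔 := ![Ideal.Quotient.mk 𝔔 (X 0), Ideal.Quotient.mk 𝔔 (X j.succ)]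
  have hx : AlgebraicIndependent ℚ x := by
    rw [algebraicIndependent_iff]
    intro p hp
    have hxe : x = fun i => Ideal.Quotient.mkₐ ℚ 𝔔 ((![X 0, X j.succ] : Fin 2 → Rx m) i) := by
      funext i
      fin_cases i <;> simp [x, Ideal.Quotient.mkₐ_eq_mk]
    have h1 : aeval x p =
        Ideal.Quotient.mkₐ ℚ 𝔔 (aeval (![X 0, X j.succ] : Fin 2 → Rx m) p) := by
      rw [← AlgHom.comp_apply, MvPolynomial.comp_aeval, ← hxe]
    rw [h1, Ideal.Quotient.mkₐ_eq_mk, Ideal.Quotient.eq_zero_iff_mem, hcone, coneIdeal,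
      RingHom.mem_ker] at hp
    change (aeval fun i : Fin (m + 1) =>
        Polynomial.C ((Fin.cons 1 z : Fin (m + 1) → ℂ) i) * Polynomial.X : Rx m →ₐ[ℚ] Polynomial ℂ)
        (aeval (![X 0, X j.succ] : Fin 2 → Rx m) p) = 0 at hp
    rw [← AlgHom.comp_apply, MvPolynomial.comp_aeval] at hp
    have hw : (fun i : Fin 2 => (aeval fun i : Fin (m + 1) =>
          Polynomial.C ((Fin.cons 1 z : Fin (m + 1) → ℂ) i) * Polynomial.X : Rx m →ₐ[ℚ] Polynomial ℂ)
          ((![X 0, X j.succ] : Fin 2 → Rx m) i)) =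
        fun i : Fin (1 + 1) => Polynomial.C ((![1, z j] : Fin (1 + 1) → ℂ) i) * Polynomial.X := by
      funext i
      fin_cases i <;> simp
    rw [hw] at hp
    have hmem : p ∈ coneIdeal (![1, z j] : Fin (1 + 1) → ℂ) := by
      rw [coneIdeal, RingHom.mem_ker]
      exact hp
    exact eq_zero_of_mem_coneIdeal_pair htrans hmem
  have h2 := hx.cardinalMk_le_trdeg
  rw [Cardinal.mk_fin, htr] at h2
  norm_num at h2

/-! ## §E3  No point of `V(𝔔)` at infinity -/

/-- The homogenisation `∑ₖ pₖ x_{j+1}^k x₀^{N-k}` of a one-variable polynomial `p` of degree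
`≤ N`, placed on the coordinate `x_{j+1}`. -/
def homog1 {m : ℕ} (p : Polynomial ℚ) (N : ℕ) (j : Fin m) : Rx m :=
  ∑ k ∈ Finset.range (N + 1), C (p.coeff k) * X j.succ ^ k * X 0 ^ (N - k)

/-- `homog1 p N j` is homogeneous of degree `N`. -/
theorem homog1_isHomogeneous {m : ℕ} (p : Polynomial ℚ) (N : ℕ) (j : Fin m) :
    (homog1 p N j).IsHomogeneous N := by
  classical
  unfold homog1
  refine IsHomogeneous.sum _ _ _ fun k hk => ?_
  have hk' : k ≤ N := Nat.lt_succ_iff.mp (Finset.mem_range.mp hk)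
  have h : ((C (p.coeff k) : Rx m) * X j.succ ^ k * X 0 ^ (N - k)).IsHomogeneous
      (0 + 1 * k + 1 * (N - k)) :=
    ((isHomogeneous_C _ _).mul ((isHomogeneous_X ℚ _).pow k)).mul ((isHomogeneous_X ℚ _).pow _)
  have e : 0 + 1 * k + 1 * (N - k) = N := by omega
  rwa [e] at h

/-- On the affine chart `x₀ = 1`, `homog1 p N j` evaluates to `p (z j)` (for `natDegree p ≤ N`). -/
theorem aeval_homog1_cons_one {m : ℕ} (p : Polynomial ℚ) {N : ℕ} (hN : p.natDegree ≤ N)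
    (j : Fin m) (z : Fin m → ℂ) :
    aeval (Fin.cons 1 z : Fin (m + 1) → ℂ) (homog1 p N j) = Polynomial.aeval (z j) p := by
  classical
  unfold homog1
  rw [map_sum, Polynomial.aeval_eq_sum_range' (Nat.lt_succ_of_le hN)]
  refine Finset.sum_congr rfl fun k _ => ?_
  simp [Algebra.smul_def]

/-- At a point with `β 0 = 0`, `homog1 p N j` evaluates to `p_N · β_{j+1} ^ N`. -/
theorem aeval_homog1_of_zero {m : ℕ} (p : Polynomial ℚ) (N : ℕ) (j : Fin m) {β : Fin (m + 1) → ℂ} (hβ : β 0 = 0) :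
    aeval β (homog1 p N j) = algebraMap ℚ ℂ (p.coeff N) * β j.succ ^ N := by
  classical
  unfold homog1
  rw [map_sum, Finset.sum_eq_single_of_mem N (Finset.mem_range.mpr (Nat.lt_succ_self N))]
  · simp
  · intro k hk hkN
    have hk' : k < N := lt_of_le_of_ne (Nat.lt_succ_iff.mp (Finset.mem_range.mp hk)) hkN
    have hpos : N - k ≠ 0 := by omega
    simp [hβ, zero_pow hpos]

/-- For a rank-one homogeneous prime through the affine point `(1 : z)`, no point of `V(𝔔)` lies
on the hyperplane at infinity `x₀ = 0`. -/
theorem apply_zero_ne_zero_of_rank_one {m : ℕ} {𝔔 : Ideal (Rx m)} (h𝔔 : 𝔔.IsPrime)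
    (h𝔔c : ∀ g ∈ 𝔔, ∀ k : ℕ, homogeneousComponent k g ∈ 𝔔) (h1 : IsUnmixedOfRank 𝔔 1)
    {z : Fin m → ℂ} (hz : (Fin.cons 1 z : Fin (m + 1) → ℂ) ∈ projZeros 𝔔)
    {β : Fin (m + 1) → ℂ} (hβ : β ∈ projZeros 𝔔) : β 0 ≠ 0 := by
  classical
  intro hβ0
  have hcone := eq_coneIdeal_of_rank_one h𝔔 h𝔔c h1 hz
  apply hβ.1
  refine funext fun i => ?_
  refine Fin.cases ?_ (fun j => ?_) i
  · simpa using hβ0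
  · obtain ⟨p, hp0, hpz⟩ := isAlgebraic_of_rank_one h𝔔 h𝔔c h1 hz j
    have hmem : homog1 p p.natDegree j ∈ 𝔔 := by
      rw [hcone, mem_coneIdeal_iff_of_isHomogeneous (homog1_isHomogeneous p p.natDegree j),
        aeval_homog1_cons_one p le_rfl j z, hpz]
    have hev := hβ.2 _ hmem
    rw [aeval_homog1_of_zero p p.natDegree j hβ0, mul_eq_zero] at hev
    rcases hev with h | h
    · exact absurd ((map_eq_zero_iff _ (algebraMap ℚ ℂ).injective).mp h)
        (Polynomial.leadingCoeff_ne_zero.mpr hp0)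
    · by_cases hdeg : p.natDegree = 0
      · exfalso
        have hc : p = Polynomial.C (p.coeff 0) := Polynomial.eq_C_of_natDegree_eq_zero hdeg
        rw [hc, Polynomial.aeval_C, map_eq_zero_iff _ (algebraMap ℚ ℂ).injective] at hpz
        apply hp0
        rw [hc, hpz, map_zero]
      · simpa using (pow_eq_zero_iff hdeg).mp h

end IsolatedPt

end Summit.Schanuel.Schanuel.Theorems.RootDecomp1BMovingZero

end
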